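import Summits.CriticalPhenomena.PercolationContinuityZ3.Theorems.PercNearOneGluingNoHeavyLowerTailSahiC3CubeFourFKG
import HarnessLib
import HarnessLib.Audit

/-!
# `NoHeavyLowerTail` (crux stmt-CriticalPhenomena-4575), Sahi programme P4: corollaries of Sahi's `C₃` on `{0,1}⁴` for every FKG weight, I —
# cubes with at most four coordinates, four-coordinate intersections in any dimension, shape of a minimal counterexample (standard axioms)

Support file (cell `prim-l12`, seat P4; `--supports stmt-CriticalPhenomena-4575`).  No named facts, no sorries; axioms `propext`,
`Classical.choice`, `Quot.sound` only.  Everything rests on `SahiC3CubeFourFKG.sahiC3_cube_four_fkg` (`…SahiC3CubeFourFKG`).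

* `sahiC3_cube_fkg_of_embedding` / `sahiC3_cube_fkg_of_card_le_four`: `0 ≤ latticeE3 μ U A B` for every nonnegative log-supermodular
  weight on a cube `ι → Bool` with `|ι| ≤ 4` (zero-extension `extB` along `ι ↪ Fin 4` is a lattice embedding; `fkgCondition_pushWeight`,
  `latticeE3_preim`); `sahiPositive_three_cube_of_card_le_four : |ι| ≤ 4 → IsFKGMeasure μ → SahiPositive μ 3`.
* `latticeE3_nonneg_cube_of_inter_determined_four{,₁₂,₁₃}` (+ function form, `sahiE μ 3` form): for every FKG weight on ANY cube
  `ι → Bool`, `C₃` holds for `(U, A, B)` as soon as one pairwise intersection depends on at most four coordinates (FKG locality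
  `SahiE3DeterminedMeetFKG.latticeE3_nonneg_of_inter_determined_of_quotient`; upgrades the three-coordinate class of
  `…SahiE3DeterminedMeetFKGCube`).
* `exists_triSaturated_neg_of_neg`: a violation of `C₃` on a cube forces a TRI-SATURATED violating triple none of whose pairwise intersections is
  determined by four coordinates — a minimal FKG counterexample has all three pairwise intersections depending on at least five coordinates.

Part II (`…SahiC3CubeFourFKGLattices`): Sahi's power set `2^X` (`|X| ≤ 4`), Kahn's Conjecture 5 on four coordinates with standard axioms,
every FKG poset with at most four join-irreducibles.
-/

namespace Summit.CriticalPhenomena.PercolationContinuityZ3.Theorems.SahiC3CubeFourFKG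

open Finset Literature.Probability.LatticeModels Literature.Combinatorics.Sahi2008 SahiC3Cube

/-! ### Cubes of dimension at most four -/

section CardLeFour

open SahiE3DeterminedMeetFKG (preim mem_preim latticeE3_preim isUpperSet_preim)

variable {ι : Type*} [Fintype ι]

/-- Extension by `false` along an embedding of the coordinates: `σ y j = y i` if `j = f i`, `false` off the image. [this work] -/
def extB (f : ι ↪ Fin 4) (y : ι → Bool) : Fin 4 → Bool := fun j => decide (∃ i, f i = j ∧ y i = true)

/-- On the image, `extB f y (f i) = y i`. [this work] -/
theorem extB_apply_image (f : ι ↪ Fin 4) (y : ι → Bool) (i : ι) : extB f y (f i) = y i := by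
  unfold extB
  cases hy : y i
  · exact decide_eq_false fun ⟨i', hi', h'⟩ => by rw [f.injective hi'] at h'; rw [hy] at h'; exact Bool.noConfusion h'
  · exact decide_eq_true ⟨i, rfl, hy⟩

/-- Off the image, `extB f y j = false`. [this work] -/
theorem extB_apply_of_not (f : ι ↪ Fin 4) (y : ι → Bool) {j : Fin 4} (hj : ¬ ∃ i, f i = j) : extB f y j = false := by
  unfold extB
  exact decide_eq_false fun ⟨i, hi, _⟩ => hj ⟨i, hi⟩

/-- `extB f` preserves meets. [this work] -/
theorem extB_inf (f : ι ↪ Fin 4) (a b : ι → Bool) : extB f (a ⊓ b) = extB f a ⊓ extB f b := by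
  funext j
  rw [Pi.inf_apply]
  by_cases h : ∃ i, f i = j
  · obtain ⟨i, rfl⟩ := h
    rw [extB_apply_image, extB_apply_image, extB_apply_image, Pi.inf_apply]
  · rw [extB_apply_of_not f _ h, extB_apply_of_not f _ h, extB_apply_of_not f _ h]; rfl

/-- `extB f` preserves joins. [this work] -/
theorem extB_sup (f : ι ↪ Fin 4) (a b : ι → Bool) : extB f (a ⊔ b) = extB f a ⊔ extB f b := by
  funext j
  rw [Pi.sup_apply]
  by_cases h : ∃ i, f i = j
  · obtain ⟨i, rfl⟩ := h
    rw [extB_apply_image, extB_apply_image, extB_apply_image, Pi.sup_apply]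
  · rw [extB_apply_of_not f _ h, extB_apply_of_not f _ h, extB_apply_of_not f _ h]; rfl

/-- Restricting the extension gives the point back. [this work] -/
theorem extB_comp (f : ι ↪ Fin 4) (y : ι → Bool) : extB f y ∘ f = y := by
  funext i
  exact extB_apply_image f y i

variable [DecidableEq ι]

/-- **Sahi's `C₃` on every cube with at most four coordinates, every FKG weight** (via the lattice embedding `extB f` into `2⁴`: the
push-forward weight is log-supermodular by `fkgCondition_pushWeight`, masses of the pulled-back sets agree, and `sahiC3_cube_four_fkg`). [this work] -/
theorem sahiC3_cube_fkg_of_embedding (f : ι ↪ Fin 4) {μ : (ι → Bool) → ℝ} (hμ₀ : 0 ≤ μ)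
    (hμ : ∀ a b, μ a * μ b ≤ μ (a ⊓ b) * μ (a ⊔ b)) (U A B : Finset (ι → Bool)) (hU : IsUpperSet (U : Set (ι → Bool)))
    (hA : IsUpperSet (A : Set (ι → Bool))) (hB : IsUpperSet (B : Set (ι → Bool))) : 0 ≤ latticeE3 μ U A B := by
  let G : (Fin 4 → Bool) → (ι → Bool) := fun x => x ∘ f
  have hG : Monotone G := fun x y hxy i => hxy (f i)
  have hback : ∀ S : Finset (ι → Bool), preim (extB f) (preim G S) = S := by
    intro S; ext y; rw [mem_preim, mem_preim]
    show extB f y ∘ f ∈ S ↔ y ∈ S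
    rw [extB_comp]
  rw [← hback U, ← hback A, ← hback B, latticeE3_preim]
  exact sahiC3_cube_four_fkg (fun c => pushWeight_nonneg (fun b => hμ₀ b) (extB f) c)
    (fkgCondition_pushWeight (fun b => hμ₀ b) hμ (extB_inf f) (extB_sup f)) _ _ _ (isUpperSet_preim hG hU) (isUpperSet_preim hG hA)
    (isUpperSet_preim hG hB)

/-- **Sahi's `C₃` on `ι → Bool` for `|ι| ≤ 4`, every FKG weight, all up-set triples.** [this work] -/
theorem sahiC3_cube_fkg_of_card_le_four (hι : Fintype.card ι ≤ 4) {μ : (ι → Bool) → ℝ} (hμ₀ : 0 ≤ μ)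
    (hμ : ∀ a b, μ a * μ b ≤ μ (a ⊓ b) * μ (a ⊔ b)) (U A B : Finset (ι → Bool)) (hU : IsUpperSet (U : Set (ι → Bool)))
    (hA : IsUpperSet (A : Set (ι → Bool))) (hB : IsUpperSet (B : Set (ι → Bool))) : 0 ≤ latticeE3 μ U A B := by
  obtain ⟨f⟩ : Nonempty (ι ↪ Fin 4) := Function.Embedding.nonempty_of_card_le (by simpa using hι)
  exact sahiC3_cube_fkg_of_embedding f hμ₀ hμ U A B hU hA hB

/-- **`SahiConjecture 3` on every cube with at most four coordinates**: `IsFKGMeasure μ → SahiPositive μ 3` for `μ` on `ι → Bool`, `|ι| ≤ 4`.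
[this work] -/
theorem sahiPositive_three_cube_of_card_le_four (hι : Fintype.card ι ≤ 4) {μ : (ι → Bool) → ℝ} (hμ : IsFKGMeasure μ) :
    SahiPositive μ 3 := by
  intro g hg0 hg
  have e : g = ![g 0, g 1, g 2] := by
    funext i; fin_cases i <;> rfl
  rw [e, ← SahiE3DeterminedMeetFKG.latticeE3fun_eq_sahiE_three hμ.sum_eq_one]
  exact latticeE3fun_nonneg_of_indicator
    (fun U A B hU hA hB => sahiC3_cube_fkg_of_card_le_four hι (fun x => hμ.nonneg x) hμ.mul_le_mul U A B hU hA hB)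
    (hg 0) (hg 1) (hg 2) (hg0 0) (hg0 1) (hg0 2)

end CardLeFour

/-! ### Any cube: a pairwise intersection depending on at most four coordinates -/

section JuntaFour

open SahiE3DeterminedMeetFKG (latticeE3_nonneg_of_inter_determined_of_quotient inf_apply_bool latticeE3fun_nonneg_of_forall_upperSet₁)

variable {ι : Type*} [Fintype ι] [DecidableEq ι]

/-- The indicator configuration of the coordinates `e 0, …, e (k-1)`. [this work] -/
def blockCfgN {k : ℕ} (e : Fin k → ι) : ι → Bool := fun i => decide (∃ j, e j = i)

omit [Fintype ι] in
/-- Agreement on the coordinates `e` is agreement below the block configuration. [this work] -/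
theorem restrict_eq_iffN {k : ℕ} (e : Fin k → ι) (x y : ι → Bool) : x ∘ e = y ∘ e ↔ x ⊓ blockCfgN e = y ⊓ blockCfgN e := by
  constructor
  · intro h
    funext i
    rw [inf_apply_bool, inf_apply_bool]
    by_cases hi : ∃ j, e j = i
    · obtain ⟨j, rfl⟩ := hi
      have hj : x (e j) = y (e j) := congrFun h j
      rw [hj]
    · have hw : blockCfgN e i = false := by simp [blockCfgN, hi]
      rw [hw, Bool.and_false, Bool.and_false]
  · intro h
    funext j
    have hi : blockCfgN e (e j) = true := by
      simp only [blockCfgN, decide_eq_true_eq]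
      exact ⟨j, rfl⟩
    have h1 := congrFun h (e j)
    rw [inf_apply_bool, inf_apply_bool, hi, Bool.and_true, Bool.and_true] at h1
    exact h1

/-- **Sahi's `C₃` for every FKG weight on any cube when `A ∩ B` depends on four coordinates**: `μ ≥ 0` log-supermodular on `ι → Bool`,
`U, A, B` up-sets, `e : Fin 4 → ι` injective with membership in `A ∩ B` depending only on the coordinates `e j` ⇒ `0 ≤ latticeE3 μ U A B`
(locality `…SahiE3DeterminedMeetFKGCube.latticeE3_nonneg_of_inter_determined_of_quotient` over `sahiC3_cube_four_fkg`; upgrades the tree's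
three-coordinate class). [this work] -/
theorem latticeE3_nonneg_cube_of_inter_determined_four {μ : (ι → Bool) → ℝ} (hμ₀ : 0 ≤ μ)
    (hμ : ∀ a b, μ a * μ b ≤ μ (a ⊓ b) * μ (a ⊔ b)) {e : Fin 4 → ι} (he : Function.Injective e)
    {U A B : Finset (ι → Bool)} (hU : IsUpperSet (U : Set (ι → Bool))) (hA : IsUpperSet (A : Set (ι → Bool)))
    (hB : IsUpperSet (B : Set (ι → Bool))) (hK : ∀ x y : ι → Bool, x ∘ e = y ∘ e → (x ∈ A ∩ B ↔ y ∈ A ∩ B)) :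
    0 ≤ latticeE3 μ U A B := by
  let G : (ι → Bool) → (Fin 4 → Bool) := fun x => x ∘ e
  have hsup : ∀ a b : ι → Bool, G (a ⊔ b) = G a ⊔ G b := fun _ _ => rfl
  have hinf : ∀ a b : ι → Bool, G (a ⊓ b) = G a ⊓ G b := fun _ _ => rfl
  have hGs : Function.Surjective G := he.surjective_comp_right
  have hw : ∀ x y : ι → Bool, G x = G y ↔ x ⊓ blockCfgN e = y ⊓ blockCfgN e := fun x y => restrict_eq_iffN e x y
  refine latticeE3_nonneg_of_inter_determined_of_quotient hμ₀ hμ G hsup hGs (blockCfgN e) hw ?_ hU hA hB ?_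
  · intro V A' B' hV hA' hB'
    exact sahiC3_cube_four_fkg (fun c => pushWeight_nonneg (fun b => hμ₀ b) G c) (fkgCondition_pushWeight (fun b => hμ₀ b) hμ hinf hsup)
      V A' B' hV hA' hB'
  · intro x
    refine hK x (x ⊓ blockCfgN e) ((hw x _).2 ?_)
    rw [inf_assoc, inf_idem]

/-- The same class with the constrained intersection `U ∩ A`. [this work] -/
theorem latticeE3_nonneg_cube_of_inter_determined_four₁₂ {μ : (ι → Bool) → ℝ} (hμ₀ : 0 ≤ μ)
    (hμ : ∀ a b, μ a * μ b ≤ μ (a ⊓ b) * μ (a ⊔ b)) {e : Fin 4 → ι} (he : Function.Injective e)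
    {U A B : Finset (ι → Bool)} (hU : IsUpperSet (U : Set (ι → Bool))) (hA : IsUpperSet (A : Set (ι → Bool)))
    (hB : IsUpperSet (B : Set (ι → Bool))) (hK : ∀ x y : ι → Bool, x ∘ e = y ∘ e → (x ∈ U ∩ A ↔ y ∈ U ∩ A)) :
    0 ≤ latticeE3 μ U A B := by
  rw [latticeE3_comm₂₃, latticeE3_comm₁₂]
  exact latticeE3_nonneg_cube_of_inter_determined_four hμ₀ hμ he hB hU hA hK

/-- The same class with the constrained intersection `U ∩ B`. [this work] -/
theorem latticeE3_nonneg_cube_of_inter_determined_four₁₃ {μ : (ι → Bool) → ℝ} (hμ₀ : 0 ≤ μ)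
    (hμ : ∀ a b, μ a * μ b ≤ μ (a ⊓ b) * μ (a ⊔ b)) {e : Fin 4 → ι} (he : Function.Injective e)
    {U A B : Finset (ι → Bool)} (hU : IsUpperSet (U : Set (ι → Bool))) (hA : IsUpperSet (A : Set (ι → Bool)))
    (hB : IsUpperSet (B : Set (ι → Bool))) (hK : ∀ x y : ι → Bool, x ∘ e = y ∘ e → (x ∈ U ∩ B ↔ y ∈ U ∩ B)) :
    0 ≤ latticeE3 μ U A B := by
  rw [latticeE3_comm₁₂]
  exact latticeE3_nonneg_cube_of_inter_determined_four hμ₀ hμ he hA hU hB hK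

/-- **Function form**: `0 ≤ latticeE3fun μ u 1_A 1_B` for every nonnegative monotone `u` when `A ∩ B` depends on four coordinates. [this work] -/
theorem latticeE3fun_nonneg_cube_of_inter_determined_four {μ : (ι → Bool) → ℝ} (hμ₀ : 0 ≤ μ)
    (hμ : ∀ a b, μ a * μ b ≤ μ (a ⊓ b) * μ (a ⊔ b)) {e : Fin 4 → ι} (he : Function.Injective e)
    {u : (ι → Bool) → ℝ} (hu : Monotone u) (hu0 : ∀ x, 0 ≤ u x)
    {A B : Finset (ι → Bool)} (hA : IsUpperSet (A : Set (ι → Bool))) (hB : IsUpperSet (B : Set (ι → Bool)))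
    (hK : ∀ x y : ι → Bool, x ∘ e = y ∘ e → (x ∈ A ∩ B ↔ y ∈ A ∩ B)) : 0 ≤ latticeE3fun μ u (ind A) (ind B) :=
  latticeE3fun_nonneg_of_forall_upperSet₁ (fun _ hU => latticeE3_nonneg_cube_of_inter_determined_four hμ₀ hμ he hU hA hB hK) hu hu0

/-- **Sahi's `E₃(u, 1_A, 1_B) ≥ 0` for every FKG probability weight on any cube** when membership in `A ∩ B` depends on four coordinates.
[this work] -/
theorem sahiE_three_nonneg_cube_of_inter_determined_four {μ : (ι → Bool) → ℝ} (hμ : IsFKGMeasure μ)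
    {e : Fin 4 → ι} (he : Function.Injective e) {u : (ι → Bool) → ℝ} (hu : Monotone u) (hu0 : ∀ x, 0 ≤ u x)
    {A B : Finset (ι → Bool)} (hA : IsUpperSet (A : Set (ι → Bool))) (hB : IsUpperSet (B : Set (ι → Bool)))
    (hK : ∀ x y : ι → Bool, x ∘ e = y ∘ e → (x ∈ A ∩ B ↔ y ∈ A ∩ B)) : 0 ≤ sahiE μ 3 ![u, ind A, ind B] := by
  rw [← SahiE3DeterminedMeetFKG.latticeE3fun_eq_sahiE_three hμ.sum_eq_one]
  exact latticeE3fun_nonneg_cube_of_inter_determined_four (fun x => hμ.nonneg x) hμ.mul_le_mul he hu hu0 hA hB hK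

end JuntaFour

/-! ### Shape of a minimal counterexample on a cube -/

section Residual

variable {ι : Type*} [Fintype ι] [DecidableEq ι]

/-- **Where a counterexample to `C₃` on a cube must live.**  If `latticeE3 μ U A B < 0` for some nonnegative log-supermodular weight on
`ι → Bool` and up-sets `U, A, B`, then there is a TRI-SATURATED up-set triple with `latticeE3 < 0` none of whose three pairwise intersections
is determined by four coordinates (tri-saturation reduction `C3Transport.forall_latticeE3_nonneg_of_triSaturated` + the four-coordinate
locality class). [this work] -/
theorem exists_triSaturated_neg_of_neg {μ : (ι → Bool) → ℝ} (hμ₀ : 0 ≤ μ) (hμ : ∀ a b, μ a * μ b ≤ μ (a ⊓ b) * μ (a ⊔ b))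
    {U A B : Finset (ι → Bool)} (hU : IsUpperSet (U : Set (ι → Bool))) (hA : IsUpperSet (A : Set (ι → Bool)))
    (hB : IsUpperSet (B : Set (ι → Bool))) (hneg : latticeE3 μ U A B < 0) :
    ∃ U' A' B' : Finset (ι → Bool), IsUpperSet (U' : Set (ι → Bool)) ∧ IsUpperSet (A' : Set (ι → Bool)) ∧
      IsUpperSet (B' : Set (ι → Bool)) ∧ C3Transport.TriSaturated U' A' B' ∧ latticeE3 μ U' A' B' < 0 ∧
      ∀ e : Fin 4 → ι, Function.Injective e →
        (¬ ∀ x y : ι → Bool, x ∘ e = y ∘ e → (x ∈ A' ∩ B' ↔ y ∈ A' ∩ B')) ∧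
        (¬ ∀ x y : ι → Bool, x ∘ e = y ∘ e → (x ∈ U' ∩ A' ↔ y ∈ U' ∩ A')) ∧
        (¬ ∀ x y : ι → Bool, x ∘ e = y ∘ e → (x ∈ U' ∩ B' ↔ y ∈ U' ∩ B')) := by
  classical
  have key : ¬ ∀ U' A' B' : Finset (ι → Bool), IsUpperSet (U' : Set (ι → Bool)) → IsUpperSet (A' : Set (ι → Bool)) →
      IsUpperSet (B' : Set (ι → Bool)) → C3Transport.TriSaturated U' A' B' → 0 ≤ latticeE3 μ U' A' B' :=
    fun h => not_le.2 hneg (C3Transport.forall_latticeE3_nonneg_of_triSaturated hμ₀ hμ h U A B hU hA hB)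
  push Not at key
  obtain ⟨U', A', B', hU', hA', hB', hT, hlt⟩ := key
  refine ⟨U', A', B', hU', hA', hB', hT, hlt, fun e he => ⟨fun hK => ?_, fun hK => ?_, fun hK => ?_⟩⟩
  · exact not_le.2 hlt (latticeE3_nonneg_cube_of_inter_determined_four hμ₀ hμ he hU' hA' hB' hK)
  · exact not_le.2 hlt (latticeE3_nonneg_cube_of_inter_determined_four₁₂ hμ₀ hμ he hU' hA' hB' hK)
  · exact not_le.2 hlt (latticeE3_nonneg_cube_of_inter_determined_four₁₃ hμ₀ hμ he hU' hA' hB' hK)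

end Residual

end Summit.CriticalPhenomena.PercolationContinuityZ3.Theorems.SahiC3CubeFourFKG
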